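import Summits.CriticalPhenomena.SAWScalingLimit.Theorems.SAWLoopFugacityFlowIsingBoundaryRatioWindowRectPolygonAvoid
import Summits.CriticalPhenomena.SAWScalingLimit.Theorems.SAWLoopFugacityFlowIsingBoundaryRatioSideCrossSeparationHelpers2
import HarnessLib

/-!
# Whiskers: feet and tails of rough boundary darts
(line `fk-anchor-transfer`, crux `IsingBoundaryRatio`, stmt-CriticalPhenomena-10650; helper file of the stub
`windowRectPresentation_holds`)

For an arrow `d = (x, k)` of `δℤ²` whose lattice point `δx` lies in an open set `U` while its edge
`[δx, δ(x + e_k)]` leaves `U`, the **foot** is the first point `framePt δ d s⋆ 0` (`0 < s⋆ ≤ δ`) of the edge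
outside `U`; it lies on `frontier U` and the edge before it in `U` (`exists_foot`). The **tail** is the part
`η ≤ s ≤ s⋆` of the edge beyond the bud of `d`. We record the lattice geometry of tails used by the
non-interleaving theorem: rays from one lattice point in different directions meet only there (`ray_eq`),
tails miss the offset boundary polygon (`tail_not_mem_range_arcPath`), the closed edges of `E`
(`tail_not_mem_edge`), the squares of size `2η` about the other vertices (`tail_far`), and the foot parameters
from the two ends of an edge crossed by the exterior are separated (`foot_lt_of_not_mem_closure`). [folklore]
-/

noncomputable section

open scoped Classical
open Set Metric Complex Literature.Probability.LatticeModels Literature.Probability.LatticeModels.DiscreteRect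

namespace Summit.CriticalPhenomena.SAWScalingLimit.Theorems.IsingBoundaryRatio

namespace WindowRect

variable {δ η : ℝ} {E : Finset (Sym2 (Site 2))}

/-! ### Rays and edges in frames -/

/-- The origin of a frame is its lattice point. [folklore] -/
theorem framePt_origin (x : Site 2) (k : Fin 4) : framePt δ (x, k) 0 0 = meshPoint δ x := by
  simp [framePt, meshPoint]

/-- The point at parameter `δ` on the ray of `(x, k)` is the neighbouring lattice point. [folklore] -/
theorem framePt_far (x : Site 2) (k : Fin 4) : framePt δ (x, k) δ 0 = meshPoint δ (x + dir k) := by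
  simp only [framePt, meshPoint_add_dir]
  simp [meshPoint]

/-- A point of the lattice edge from `x` in direction `k` is a ray point with parameter in `[0, δ]`.
[folklore] -/
theorem exists_of_mem_edge (hδ : 0 < δ) {x : Site 2} {k : Fin 4} {z : ℂ}
    (hz : z ∈ segment ℝ (meshPoint δ x) (meshPoint δ (x + dir k))) : ∃ t ∈ Icc 0 δ, z = framePt δ (x, k) t 0 := by
  rw [← framePt_origin x k, ← framePt_far x k] at hz
  exact exists_of_mem_segment_fst hδ.le hz

/-- **Rays from one lattice point in different directions meet only at that point.** [folklore] -/
theorem ray_eq {x : Site 2} {k k' : Fin 4} {s t : ℝ} (hs : 0 < s) (ht : 0 ≤ t)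
    (h : framePt δ (x, k') t 0 = framePt δ (x, k) s 0) : k' = k ∧ t = s := by
  rcases framePt_eq_frame (δ := δ) x k' k t 0 with ⟨hK, h'⟩ | ⟨hK, h'⟩ | ⟨hK, h'⟩ | ⟨hK, h'⟩ <;>
    rw [h', framePt_inj_iff] at h <;> obtain ⟨h1, h2⟩ := h
  · exact ⟨hK, h1⟩
  · linarith
  · linarith
  · linarith

/-! ### The foot of an arrow leaving an open set -/

/-- **The foot.** If `δx ∈ U` (open) and the edge `[δx, δ(x + e_k)]` has a point outside `U`, there is a
first such point `framePt δ (x, k) s⋆ 0`, `0 < s⋆ ≤ δ`: it lies on `frontier U`, outside `U`, and the ray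
before it lies in `U`. [folklore] -/
theorem exists_foot (hδ : 0 < δ) {U : Set ℂ} (hU : IsOpen U) {x : Site 2} {k : Fin 4}
    (hx : meshPoint δ x ∈ U) (h : ∃ z ∈ segment ℝ (meshPoint δ x) (meshPoint δ (x + dir k)), z ∉ U) :
    ∃ s ∈ Ioc 0 δ, framePt δ (x, k) s 0 ∈ frontier U ∧ framePt δ (x, k) s 0 ∉ U ∧
      ∀ s' ∈ Ico 0 s, framePt δ (x, k) s' 0 ∈ U := by
  obtain ⟨z, hz, hzU⟩ := h
  obtain ⟨t₀, ht₀, rfl⟩ := exists_of_mem_edge hδ hz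
  set T : Set ℝ := Icc 0 δ ∩ (fun s => framePt δ (x, k) s 0) ⁻¹' Uᶜ with hT
  have hcont : Continuous fun s : ℝ => framePt δ (x, k) s 0 := by
    simp only [framePt, meshPoint]; fun_prop
  have hTc : IsClosed T := isClosed_Icc.inter (hU.isClosed_compl.preimage hcont)
  have hTne : T.Nonempty := ⟨t₀, ht₀, hzU⟩
  have hTbdd : BddBelow T := ⟨0, fun t ht => ht.1.1⟩
  set s := sInf T with hs
  have hsT : s ∈ T := hTc.csInf_mem hTne hTbdd
  have hbefore : ∀ s' ∈ Ico 0 s, framePt δ (x, k) s' 0 ∈ U := by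
    intro s' hs'
    by_contra hc
    have : s ≤ s' := csInf_le hTbdd ⟨⟨hs'.1, hs'.2.le.trans hsT.1.2⟩, hc⟩
    linarith [hs'.2]
  have hs0 : 0 < s := by
    rcases hsT.1.1.eq_or_lt with h | h
    · exfalso; apply hsT.2; show framePt δ (x, k) s 0 ∈ U; rw [← h, framePt_origin]; exact hx
    · exact h
  refine ⟨s, ⟨hs0, hsT.1.2⟩, ?_, hsT.2, hbefore⟩
  rw [hU.frontier_eq]
  refine ⟨?_, hsT.2⟩
  -- limit of points of `U` from below
  have htend : Filter.Tendsto (fun n : ℕ => framePt δ (x, k) (s - s / (n + 2)) 0) Filter.atTop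
      (nhds (framePt δ (x, k) s 0)) := by
    have h1 : Filter.Tendsto (fun n : ℕ => s - s / ((n : ℝ) + 2)) Filter.atTop (nhds s) := by
      have : Filter.Tendsto (fun n : ℕ => s / ((n : ℝ) + 2)) Filter.atTop (nhds 0) :=
        tendsto_const_nhds.div_atTop (Filter.tendsto_atTop_add_const_right _ _ tendsto_natCast_atTop_atTop)
      simpa using tendsto_const_nhds.sub this
    exact (hcont.tendsto s).comp h1
  refine mem_closure_of_tendsto htend (Filter.Eventually.of_forall fun n => hbefore _ ⟨?_, ?_⟩)
  · have : s / ((n : ℝ) + 2) ≤ s := div_le_self hs0.le (by linarith [n.cast_nonneg (α := ℝ)])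
    linarith
  · have : 0 < s / ((n : ℝ) + 2) := div_pos hs0 (by positivity)
    linarith

/-- **Feet from the two ends of an edge crossed by the exterior are separated**: if the foot from `x` is at
parameter `s` and some point of the edge at parameter `sₑ` lies outside `closure U`, then `s < sₑ`.
[folklore] -/
theorem foot_lt_of_not_mem_closure {U : Set ℂ} {x : Site 2} {k : Fin 4} {s sₑ : ℝ}
    (hfr : framePt δ (x, k) s 0 ∈ frontier U) (hbefore : ∀ s' ∈ Ico 0 s, framePt δ (x, k) s' 0 ∈ U) (hsₑ0 : 0 ≤ sₑ)
    (he : framePt δ (x, k) sₑ 0 ∉ closure U) : s < sₑ := by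
  by_contra h
  push Not at h
  rcases h.eq_or_lt with h | h
  · rw [h] at he; exact he (frontier_subset_closure hfr)
  · exact he (subset_closure (hbefore sₑ ⟨hsₑ0, h⟩))

/-! ### Tails miss the polygon -/

/-- **A tail point beyond the bud misses the offset boundary polygon**, provided the tail stops `2η` before
the far lattice point whenever that point is a vertex of `E` (the polygon consists of sides of squares about
vertices of `E` and connectors alongside edges of `E`). [folklore] -/
theorem tail_not_mem_range_arcPath (hδ : 0 < δ) (hη : 0 < η) (h4 : 4 * η ≤ δ) {d₀ : Site 2 × Fin 4}
    (hd₀ : IsExtDart E d₀) (m : ℕ) {x : Site 2} {k : Fin 4} {s : ℝ} (hs : η < s) (hsδ : s ≤ δ)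
    (hstop : x + dir k ∈ verts E → s ≤ δ - 2 * η) :
    framePt δ (x, k) s 0 ∉ range (arcPath E δ η d₀ m) := by
  intro hmem
  have hsd : ∀ {i}, IsExtDart E ((succ E)^[i] d₀) := hd₀.iterate _
  rcases lt_trichotomy s (δ - η) with hlt | heq | hgt
  · -- a genuine tail point
    rcases range_arcPath_subset hη (by linarith) d₀ m hmem with ⟨i, -, hi⟩ | ⟨a, ha, t, ht, hz⟩
    · exact tail_not_side hδ hη (v := ((succ E)^[i] d₀).1) (K := ((succ E)^[i] d₀).2) ⟨hs, hlt⟩ hi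
    · exact tail_not_conn hδ hη ⟨hs, hlt⟩ ha ht hz
  · -- the bud of the reversed arrow, whose base is not a vertex
    have hy : x + dir k ∉ verts E := fun hy => by linarith [hstop hy]
    have hpt : framePt δ (x, k) s 0 = framePt δ (x + dir k, k + 2) (η + 0) 0 := by
      rw [framePt_reverse x k s 0, heq, neg_zero]; congr 1; ring
    rw [hpt] at hmem
    rcases range_arcPath_subset hη (by linarith) d₀ m hmem with ⟨i, -, hi⟩ | ⟨a, ha, t, ht, hz⟩
    · obtain ⟨hvK, -⟩ := test_side hδ hη h4 (by rw [abs_zero]; exact hη) (by rw [abs_zero]; exact hη) hi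
      apply hy
      have := (hsd (i := i)).1
      rw [show ((succ E)^[i] d₀) = (((succ E)^[i] d₀).1, ((succ E)^[i] d₀).2) from rfl, hvK] at this
      exact this
    · exact test_not_conn hδ hη h4 (by rw [abs_zero]; exact hη) (by rw [abs_zero]; exact hη) ha ht hz
  · -- inside the square about the far lattice point
    have hpt : framePt δ (x, k) s 0 = framePt δ (x + dir k, k + 2) (δ - s) 0 := by
      rw [framePt_reverse x k s 0, neg_zero]
    rw [hpt] at hmem
    have ha : |δ - s| < η := by rw [abs_lt]; constructor <;> linarith
    have hb : |(0 : ℝ)| < η := by rw [abs_zero]; exact hη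
    rcases range_arcPath_subset hη (by linarith) d₀ m hmem with ⟨i, -, hi⟩ | ⟨a, ha', t, ht, hz⟩
    · exact inside_not_side hδ hη h4 ha hb hi
    · exact inside_not_conn hδ hη h4 ha hb ha' ht hz

/-! ### Tails miss the edges of `E` -/

/-- **A point of the ray of a missing edge, strictly beyond its base point and not at a vertex far end,
lies on no closed edge of `E`.** [folklore] -/
theorem tail_not_mem_edge (hδ : 0 < δ) {x : Site 2} {k : Fin 4} (hxk : s(x, x + dir k) ∉ E) {s : ℝ}
    (hs0 : 0 < s) (hsδ : s ≤ δ) (hfar : s = δ → x + dir k ∉ verts E) {v w : Site 2} (hvw : s(v, w) ∈ E)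
    (hadj : (zdGraph 2).Adj v w) (hz : framePt δ (x, k) s 0 ∈ segment ℝ (meshPoint δ v) (meshPoint δ w)) :
    False := by
  have hz' : framePt δ (x, k) s 0 ∈ segment ℝ (meshPoint δ x) (meshPoint δ (x + dir k)) := by
    rw [← framePt_origin x k, ← framePt_far x k, segment_eq_image_lineMap]
    refine ⟨s / δ, ⟨by positivity, (div_le_one hδ).2 hsδ⟩, ?_⟩
    rw [framePt_lineMap_fst]; congr 1; field_simp; ring
  obtain ⟨m, hm1, hm2⟩ := exists_common_endpoint hδ (zdGraph_adj_add_dir x k) hadj hz' hz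
  -- the edge of `E` seen from the common endpoint `m`
  obtain ⟨K, hE, hzK⟩ : ∃ K : Fin 4, s(m, m + dir K) ∈ E ∧
      framePt δ (x, k) s 0 ∈ segment ℝ (meshPoint δ m) (meshPoint δ (m + dir K)) := by
    rcases hm2 with rfl | rfl
    · obtain ⟨K, rfl⟩ := exists_eq_add_dir_of_adj hadj
      exact ⟨K, hvw, hz⟩
    · obtain ⟨K, rfl⟩ := exists_eq_add_dir_of_adj hadj.symm
      exact ⟨K, by rw [Sym2.eq_swap]; exact hvw, by rw [segment_symm]; exact hz⟩
  obtain ⟨t, ht, hzt⟩ := exists_of_mem_edge hδ hzK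
  rcases hm1 with rfl | rfl
  · -- common endpoint `x`: same direction, the missing edge would be in `E`
    obtain ⟨rfl, -⟩ := ray_eq hs0 ht.1 hzt.symm
    exact hxk hE
  · -- common endpoint `x + e_k`
    rw [framePt_reverse x k s 0, neg_zero] at hzt
    rcases (sub_nonneg.2 hsδ).eq_or_lt with h0 | hpos
    · have hsd : s = δ := by linarith
      exact hfar hsd (mem_verts_of_mem_left hE)
    · obtain ⟨rfl, -⟩ := ray_eq hpos ht.1 hzt.symm
      apply hxk
      rw [dir_add_two, ← sub_eq_add_neg, add_sub_cancel_right, Sym2.eq_swap] at hE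
      exact hE

/-! ### Tails stay away from the other vertices -/

/-- A ray point of another direction at the same lattice point is not a point with positive first frame
coordinate. [folklore] -/
theorem ray_ne_of_pos {x : Site 2} {k k' : Fin 4} {t a c : ℝ} (ht : 0 < t) (ha : 0 < a) (hk : k' ≠ k) :
    framePt δ (x, k') t 0 ≠ framePt δ (x, k) a c := by
  intro h
  rcases framePt_eq_frame (δ := δ) x k' k t 0 with ⟨hK, h'⟩ | ⟨hK, h'⟩ | ⟨hK, h'⟩ | ⟨hK, h'⟩ <;>
    rw [h', framePt_inj_iff] at h <;> obtain ⟨h1, h2⟩ := h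
  · exact hk hK
  · linarith
  · linarith
  · linarith

/-- Integer bookkeeping for `tail_far`: `|σ s + δ n| < 2η` with `0 < s ≤ δ`, `n ≠ 0`, `σ = ±1` forces
`n = -σ` and `s > δ - 2η`. [folklore] -/
theorem int_eq_of_abs_add_lt (hδ : 0 < δ) (h4 : 4 * η ≤ δ) {s : ℝ} (hs0 : 0 < s) (hsδ : s ≤ δ) {n : ℤ} (hn : n ≠ 0)
    {σ : ℝ} (hσ : σ = 1 ∨ σ = -1) (h : |σ * s + δ * n| < 2 * η) : (n : ℝ) = -σ ∧ δ - 2 * η < s := by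
  obtain ⟨h1, h2⟩ := abs_lt.1 h
  have hlt : ∀ m : ℤ, (σ * s + δ * m < 2 * η) → -(2 * η) < σ * s + δ * m → -2 < m ∧ m < 2 := by
    intro m hhi hlo
    constructor
    · by_contra hc; push Not at hc
      have : (m : ℝ) ≤ -2 := by exact_mod_cast hc
      rcases hσ with rfl | rfl <;> nlinarith
    · by_contra hc; push Not at hc
      have : (2 : ℝ) ≤ m := by exact_mod_cast hc
      rcases hσ with rfl | rfl <;> nlinarith
  obtain ⟨hlo, hhi⟩ := hlt n h2 h1
  rcases hσ with rfl | rfl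
  · have : n = -1 ∨ n = 0 ∨ n = 1 := by omega
    rcases this with rfl | rfl | rfl
    · exact ⟨by norm_num, by push_cast at h1; linarith⟩
    · exact absurd rfl hn
    · push_cast at h2; linarith
  · have : n = -1 ∨ n = 0 ∨ n = 1 := by omega
    rcases this with rfl | rfl | rfl
    · push_cast at h1; linarith
    · exact absurd rfl hn
    · exact ⟨by norm_num, by push_cast at h2; linarith⟩

/-- An integer multiple of `δ` of absolute value `< 2η ≤ δ/2` vanishes. [folklore] -/
theorem int_eq_zero_of_abs_mul_lt (hδ : 0 < δ) (h4 : 4 * η ≤ δ) {n : ℤ} (h : |δ * n| < 2 * η) : n = 0 := by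
  by_contra hne
  have h1 : (1 : ℝ) ≤ |(n : ℝ)| := by exact_mod_cast Int.one_le_abs hne
  rw [abs_mul, abs_of_pos hδ] at h
  nlinarith

/-- **A tail stays `2η` away (in a coordinate) from every vertex of `E` other than its base point**, provided
it stops `2η` before the far lattice point when that point is a vertex. [folklore] -/
theorem tail_far (hδ : 0 < δ) (h4 : 4 * η ≤ δ) {x : Site 2} {k : Fin 4} {s : ℝ} (hs0 : 0 < s) (hsδ : s ≤ δ)
    (hstop : x + dir k ∈ verts E → s ≤ δ - 2 * η) {v : Site 2} (hv : v ∈ verts E) (hvx : v ≠ x) :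
    2 * η ≤ |(framePt δ (x, k) s 0).re - δ * v 0| ∨ 2 * η ≤ |(framePt δ (x, k) s 0).im - δ * v 1| := by
  by_contra hcon
  push Not at hcon
  obtain ⟨hre, him⟩ := hcon
  obtain ⟨cre, cim⟩ := framePt_sub_coords (δ := δ) x k s 0
  simp only [zero_mul, sub_zero, add_zero] at cre cim
  set n0 : ℤ := x 0 - v 0 with hn0
  set n1 : ℤ := x 1 - v 1 with hn1
  have ere : (framePt δ (x, k) s 0).re - δ * v 0 = (dir k 0 : ℝ) * s + δ * n0 := by
    rw [hn0]; push_cast; linarith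
  have eim : (framePt δ (x, k) s 0).im - δ * v 1 = (dir k 1 : ℝ) * s + δ * n1 := by
    rw [hn1]; push_cast; linarith
  rw [ere] at hre
  rw [eim] at him
  have hne : n0 ≠ 0 ∨ n1 ≠ 0 := by
    by_contra h; push Not at h
    exact hvx (funext fun i => by fin_cases i <;> simp <;> omega)
  -- in each direction: the perpendicular coordinate agrees, the other one forces `v = x + e_k`
  have key : ∀ {σ : ℝ} {na nb : ℤ}, (σ = 1 ∨ σ = -1) → |σ * s + δ * na| < 2 * η → |(0 : ℝ) * s + δ * nb| < 2 * η →
      (na ≠ 0 ∨ nb ≠ 0) → (na : ℝ) = -σ ∧ nb = 0 ∧ δ - 2 * η < s := by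
    intro σ na nb hσ ha hb hne
    rw [zero_mul, zero_add] at hb
    have hnb := int_eq_zero_of_abs_mul_lt hδ h4 hb
    have hna : na ≠ 0 := by rcases hne with h | h; exact h; exact absurd hnb h
    obtain ⟨e, hs⟩ := int_eq_of_abs_add_lt hδ h4 hs0 hsδ hna hσ ha
    exact ⟨e, hnb, hs⟩
  have hvy : v = x + dir k ∧ δ - 2 * η < s := by
    rcases dir_apply_cases k with ⟨h0, h1⟩ | ⟨h0, h1⟩ | ⟨h0, h1⟩ | ⟨h0, h1⟩ <;>
      rw [h0] at hre <;> rw [h1] at him <;> push_cast at hre him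
    · obtain ⟨e, e', hs⟩ := key (Or.inl rfl) hre him hne
      have en : n0 = -1 := by exact_mod_cast e
      refine ⟨funext fun i => ?_, hs⟩
      fin_cases i <;> simp [Pi.add_apply, h0, h1] <;> omega
    · obtain ⟨e, e', hs⟩ := key (Or.inl rfl) him hre hne.symm
      have en : n1 = -1 := by exact_mod_cast e
      refine ⟨funext fun i => ?_, hs⟩
      fin_cases i <;> simp [Pi.add_apply, h0, h1] <;> omega
    · obtain ⟨e, e', hs⟩ := key (Or.inr rfl) hre him hne
      have en : n0 = 1 := by rw [neg_neg] at e; exact_mod_cast e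
      refine ⟨funext fun i => ?_, hs⟩
      fin_cases i <;> simp [Pi.add_apply, h0, h1] <;> omega
    · obtain ⟨e, e', hs⟩ := key (Or.inr rfl) him hre hne.symm
      have en : n1 = 1 := by rw [neg_neg] at e; exact_mod_cast e
      refine ⟨funext fun i => ?_, hs⟩
      fin_cases i <;> simp [Pi.add_apply, h0, h1] <;> omega
  have hs2 := hstop (hvy.1 ▸ hv)
  linarith [hvy.2]

end WindowRect

/-- **Rays from one lattice point in different directions meet only at that point**, closed form
(registered sub-goal of stmt-CriticalPhenomena-10650). [folklore] -/
theorem windowRect_ray_eq : ∀ {δ : ℝ} {x : Site 2} {k k' : Fin 4} {s t : ℝ}, 0 < s → 0 ≤ t → WindowRect.framePt δ (x, k') t 0 = WindowRect.framePt δ (x, k) s 0 → k' = k ∧ t = s :=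
  fun hs ht h => WindowRect.ray_eq hs ht h

end Summit.CriticalPhenomena.SAWScalingLimit.Theorems.IsingBoundaryRatio

end
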